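import Summits.CriticalPhenomena.Ising3D.ExclusionSentences

/-!
# The joint family `KACJ` (same-model Virasoro pairs) in kernel form

SCOPE.md §3 (pub-ising3x, recog-1), frozen catalogue FAMILIES-v1, family `KACJ` of kind `DeltaPair`:
the pairs `(2 h_{r,s}(p,p′) + n, 2 h_{r′,s′}(p,p′) + n′)` of scaling dimensions of spinless (level
`n, n′ ≤ nmax`) descendants of two Kac primaries of the SAME Virasoro minimal model `M(p,p′)`,
`2 ≤ p < p′ ≤ N` coprime (non-unitary models included), exactly as `HOME/code/recog/recognise.py
rec_KACJ` / `families.py` (`N = 24`, `nmax = 8`).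

Until now the kernel certified `KACJ` only through its two projections (`kacExcluded` on the `Δ_σ`
face and on the `Δ_ε` face of a certified box, `ExclusionSentences.lean`): conclusive when one of the
two single-datum exception lists is empty, NOT conclusive at phase-1 box widths, where both lists are
long (inside the frozen counting windows `P = [0.45, 0.55] × [1.35, 1.45]` a `0.01 × 0.04` box meets
on average `12.5` resp. `63.9` single Kac values — `≈ 800` candidate pairs by projection — but only
`12.8` same-model pairs; a `10⁻³ × 10⁻³` box meets `≈ 2 × 2` single values and NO same-model pair in
`94` of `100` grid positions; `work/gen7/kacj_count.py` of the recog-1 g7 seat, frozen table only,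
no 3D digit).  This file adds the joint checker:

* `kacPairFamily N nmax : Set (ℚ × ℚ)` — the family; `fst/snd_mem_kacFamily_of_mem_kacPairFamily`
  (it projects into `kacFamily N nmax ×ˢ kacFamily N nmax`); `ising2D_mem_kacPairFamily`
  (`(1/8, 1)` from `M(3,4)`).
* `kacPairExcluded N nmax a b c d ex : Bool` — for every model, the Kac values in `[a, b]` (levels
  solved by Euclidean division, `kacNLo`/`kacNHi` of `ExclusionSentences.lean`) times those in
  `[c, d]` must all be listed in `ex : List (ℚ × ℚ)`; integer core `kacPairCore`.
* **`kacPairExcluded_sound`**: `= true` ⇒ every member of `kacPairFamily N nmax` in the box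
  `[a, b] × [c, d]` belongs to `ex`; `not_mem_kacPairFamily_of_kacPairExcluded` (`ex = []`);
  real-number form `ne_kacPair_of_kacPairExcluded`.
* Bridge **`pair_not_kacj_of_isingEnclosure`**: under `IsingEnclosure W R` with
  `R ⊆ [a, b] × [c, d]`, no admissible `σ–ε` datum in the window `W` has `(Δ_σ, Δ_ε)` equal to a
  same-model Kac pair outside `ex` — the phase-1 sentence "no Virasoro minimal model `M(p,p′)`,
  `p′ ≤ 24`, places a pair of (level `≤ 8` spinless descendants of) Kac primaries at the certified
  `(Δ_σ, Δ_ε)`, except …".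
* Rule R3: `kacPair_listed_of_subbox` — a complete list on a box gives the complete list on every
  sub-box as a `List.filter` (no table re-scan).
* 2D control (`decide +kernel`): at the COARSE joint width `10⁻³` the only same-model pair near
  `(1/8, 1)` is `(1/8, 1)` itself (`kacPairExcluded_control_pair3`, `control_pair_kacj_unique`;
  non-vacuity `kacPairExcluded_control_pair3_minimal`); synthetic validation box
  `[0.613, 0.623] × [2.713, 2.723]` (golden ratio / `e`, width `10⁻²`, no 3D digit): the complete
  list of four pairs `validationPairKacjEx`, its minimality, and the refinement instance
  `validation_subbox_not_kacj` (the `2·10⁻³` sub-box is empty).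

Python twin: `HOME/pub-ising3x-recog-1/lean/tools/kacpair_exceptions.py` (same loops, exact
integers; `--xcheck` against the recogniser of record `code/recog/recognise.py kac_by_model`;
`--lean` writes the theorem).  Hygiene: `Bool` checkers + soundness, `decide +kernel` only on closed
numerals, no `native_decide`, no new axioms.  Framing: lottery ticket; floor = tightest certified 3D
Ising CFT bounds; no exact-solution claim without a proof.
-/

namespace Summit.CriticalPhenomena.Ising3D

open Literature.MathematicalPhysics.QuantumFieldTheory.ConformalBootstrap3D

/-! ### The family -/

/-- `kacPairFamily N nmax`: FAMILIES-v1 family `KACJ` — all pairs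
`(kacValue p p′ r s n, kacValue p p′ r′ s′ n′) = (2h_{r,s} + n, 2h_{r′,s′} + n′)` from ONE Virasoro
minimal model `M(p,p′)`: coprime `2 ≤ p < p′ ≤ N`, `1 ≤ r, r′ ≤ p − 1`, `1 ≤ s, s′ ≤ p′ − 1`,
`n, n′ ≤ nmax` (cell table `N = 24`, `nmax = 8`). -/
def kacPairFamily (N nmax : ℕ) : Set (ℚ × ℚ) :=
  {v | ∃ p p' r s n r' s' n' : ℕ, 2 ≤ p ∧ p < p' ∧ p' ≤ N ∧ Nat.Coprime p p' ∧ 1 ≤ r ∧ r < p ∧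
    1 ≤ s ∧ s < p' ∧ n ≤ nmax ∧ 1 ≤ r' ∧ r' < p ∧ 1 ≤ s' ∧ s' < p' ∧ n' ≤ nmax ∧
    v = (kacValue p p' r s n, kacValue p p' r' s' n')}

/-- A `KACJ` pair projects to a `KAC` value on the `Δ_σ` axis. -/
theorem fst_mem_kacFamily_of_mem_kacPairFamily {N nmax : ℕ} {v : ℚ × ℚ}
    (hv : v ∈ kacPairFamily N nmax) : v.1 ∈ kacFamily N nmax := by
  obtain ⟨p, p', r, s, n, r', s', n', hp, hpp, hN, hcop, hr1, hr, hs1, hs, hn, -, -, -, -, -, rfl⟩ :=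
    hv
  exact ⟨p, p', r, s, n, hp, hpp, hN, hcop, hr1, hr, hs1, hs, hn, rfl⟩

/-- A `KACJ` pair projects to a `KAC` value on the `Δ_ε` axis. -/
theorem snd_mem_kacFamily_of_mem_kacPairFamily {N nmax : ℕ} {v : ℚ × ℚ}
    (hv : v ∈ kacPairFamily N nmax) : v.2 ∈ kacFamily N nmax := by
  obtain ⟨p, p', r, s, n, r', s', n', hp, hpp, hN, hcop, -, -, -, -, -, hr1, hr, hs1, hs, hn, rfl⟩ :=
    hv
  exact ⟨p, p', r', s', n', hp, hpp, hN, hcop, hr1, hr, hs1, hs, hn, rfl⟩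

/-- The 2D Ising pair `(Δ_σ, Δ_ε) = (1/8, 1) = (2h_{1,2}, 2h_{2,1})` of `M(3,4)` is a `KACJ` member
(sanity check of the conventions and non-vacuity of the control sentences below). -/
theorem ising2D_mem_kacPairFamily : ((1 / 8 : ℚ), (1 : ℚ)) ∈ kacPairFamily 24 8 := by
  simp only [kacPairFamily, Set.mem_setOf_eq]
  exact ⟨3, 4, 1, 2, 0, 2, 1, 0, by norm_num, by norm_num, by norm_num, by norm_num, by norm_num,
    by norm_num, by norm_num, by norm_num, by norm_num, by norm_num, by norm_num, by norm_num,
    by norm_num, by norm_num, by norm_num [kacValue, kacNum]⟩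

/-! ### The checker -/

/-- The admissible levels of the primary `(r, s)` of `M(p,p′)` for the interval `[an/ad, bn/bd]`:
the natural numbers of `[max 0 nlo, min nmax nhi]` (`kacNLo`/`kacNHi`: Euclidean division), as a
`List.range'` (empty when `nhi < max 0 nlo`). -/
def kacLevels (nmax : ℕ) (an : ℤ) (ad : ℕ) (bn : ℤ) (bd : ℕ) (p p' r s : ℕ) : List ℕ :=
  List.range' (max 0 (kacNLo an ad p p' r s)).toNat
    (min (nmax : ℤ) (kacNHi bn bd p p' r s) + 1 - max 0 (kacNLo an ad p p' r s)).toNat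

/-- Every level between the two bounds is listed by `kacLevels`. -/
theorem mem_kacLevels {nmax : ℕ} {an : ℤ} {ad : ℕ} {bn : ℤ} {bd : ℕ} {p p' r s : ℕ} {n : ℕ}
    (hlo : max 0 (kacNLo an ad p p' r s) ≤ (n : ℤ))
    (hhi : (n : ℤ) ≤ min (nmax : ℤ) (kacNHi bn bd p p' r s)) :
    n ∈ kacLevels nmax an ad bn bd p p' r s := by
  unfold kacLevels
  generalize max 0 (kacNLo an ad p p' r s) = lo at hlo ⊢
  generalize min (nmax : ℤ) (kacNHi bn bd p p' r s) = hi at hhi ⊢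
  rw [List.mem_range'_1]
  omega

/-- All numerators `X = kacNum p p′ r s + 2 p p′ · n` (so that the value is `X / (2 p p′)`) of the
Kac values of the model `M(p,p′)` lying in `[an/ad, bn/bd]`, over `1 ≤ r ≤ p − 1`, `1 ≤ s ≤ p′ − 1`
and the admissible levels. -/
def kacHits (nmax : ℕ) (an : ℤ) (ad : ℕ) (bn : ℤ) (bd : ℕ) (p p' : ℕ) : List ℤ :=
  (List.range' 1 (p - 1)).flatMap fun r =>
    (List.range' 1 (p' - 1)).flatMap fun s =>
      (kacLevels nmax an ad bn bd p p' r s).map fun n : ℕ =>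
        kacNum p p' r s + ((2 * p * p' : ℕ) : ℤ) * (↑n : ℤ)

/-- The numerator of an in-range Kac value is listed by `kacHits`. -/
theorem mem_kacHits {nmax : ℕ} {an : ℤ} {ad : ℕ} (had : 0 < ad) {bn : ℤ} {bd : ℕ} (hbd : 0 < bd)
    {p p' r s n : ℕ} (hD : 0 < 2 * p * p') (hr1 : 1 ≤ r) (hr : r < p) (hs1 : 1 ≤ s) (hs : s < p')
    (hn : n ≤ nmax)
    (ha : an * ((2 * p * p' : ℕ) : ℤ) ≤ (kacNum p p' r s + ((2 * p * p' : ℕ) : ℤ) * n) * (ad : ℤ))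
    (hb : (kacNum p p' r s + ((2 * p * p' : ℕ) : ℤ) * n) * (bd : ℤ) ≤ bn * ((2 * p * p' : ℕ) : ℤ)) :
    kacNum p p' r s + ((2 * p * p' : ℕ) : ℤ) * (n : ℤ) ∈ kacHits nmax an ad bn bd p p' := by
  unfold kacHits
  simp only [List.mem_flatMap, List.mem_map]
  refine ⟨r, List.mem_range'_1.mpr ⟨hr1, by omega⟩, s, List.mem_range'_1.mpr ⟨hs1, by omega⟩, n,
    mem_kacLevels ?_ ?_, rfl⟩
  · exact max_le (Int.natCast_nonneg n) (kacNLo_le had hD ha)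
  · exact le_min (by exact_mod_cast hn) (le_kacNHi hbd hD hb)

/-- Integer core of the `KACJ` checker: box `[an/ad, bn/bd] × [cn/cd, dn/dd]`, exceptions as pairs of
`(num, den)` pairs.  Loops over the models `p′ ∈ [3, N]`, `p ∈ [2, p′ − 1]` coprime to `p′`; for each
model every (first-axis hit, second-axis hit) combination must be a listed pair (cross-multiplied
against the reduced forms).  A model with no first-axis hit costs only its first-axis scan. -/
def kacPairCore (N nmax : ℕ) (an : ℤ) (ad : ℕ) (bn : ℤ) (bd : ℕ) (cn : ℤ) (cd : ℕ) (dn : ℤ)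
    (dd : ℕ) (ex : List ((ℤ × ℕ) × (ℤ × ℕ))) : Bool :=
  (List.range' 3 (N - 2)).all fun p' =>
    (List.range' 2 (p' - 2)).all fun p =>
      if Nat.Coprime p p' then
        (kacHits nmax an ad bn bd p p').all fun X =>
          (kacHits nmax cn cd dn dd p p').all fun Y =>
            ex.any fun e =>
              decide (X * (e.1.2 : ℤ) = e.1.1 * ((2 * p * p' : ℕ) : ℤ) ∧
                Y * (e.2.2 : ℤ) = e.2.1 * ((2 * p * p' : ℕ) : ℤ))
      else true

/-- `kacPairExcluded N nmax a b c d ex = true` certifies: every member of the joint family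
`KACJ(N, nmax)` lying in the box `[a, b] × [c, d]` belongs to the exception list `ex` — the
recogniser's sentence "no same-model Virasoro pair (`p′ ≤ N`, levels `≤ nmax`) in the certified box
except …" (SCOPE §3.1 family `KACJ`, §3.5). -/
def kacPairExcluded (N nmax : ℕ) (a b c d : ℚ) (ex : List (ℚ × ℚ)) : Bool :=
  kacPairCore N nmax a.num a.den b.num b.den c.num c.den d.num d.den
    (ex.map fun e => ((e.1.num, e.1.den), (e.2.num, e.2.den)))

/-- **Soundness of the `KACJ` sentence.** If `kacPairExcluded N nmax a b c d ex = true` then every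
`v ∈ kacPairFamily N nmax` with `a ≤ v.1 ≤ b` and `c ≤ v.2 ≤ d` belongs to `ex`. -/
theorem kacPairExcluded_sound {N nmax : ℕ} {a b c d : ℚ} {ex : List (ℚ × ℚ)}
    (h : kacPairExcluded N nmax a b c d ex = true) {v : ℚ × ℚ} (hv : v ∈ kacPairFamily N nmax)
    (ha : a ≤ v.1) (hb : v.1 ≤ b) (hc : c ≤ v.2) (hd : v.2 ≤ d) : v ∈ ex := by
  simp only [kacPairFamily, Set.mem_setOf_eq] at hv
  obtain ⟨p, p', r, s, n, r', s', n', hp, hpp, hN, hcop, hr1, hr, hs1, hs, hn, hr1', hr', hs1', hs',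
    hn', rfl⟩ := hv
  have hD : 0 < 2 * p * p' := Nat.mul_pos (Nat.mul_pos (by norm_num) (by omega)) (by omega)
  unfold kacPairExcluded kacPairCore at h
  have h1 := List.all_eq_true.mp h p' (List.mem_range'_1.mpr ⟨by omega, by omega⟩)
  have h2 := List.all_eq_true.mp h1 p (List.mem_range'_1.mpr ⟨hp, by omega⟩)
  rw [if_pos hcop] at h2
  have hX := mem_kacHits (nmax := nmax) a.den_pos b.den_pos hD hr1 hr hs1 hs hn
    ((le_intDiv_iff a _ hD).mp ha) ((intDiv_le_iff b _ hD).mp hb)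
  have hY := mem_kacHits (nmax := nmax) c.den_pos d.den_pos hD hr1' hr' hs1' hs' hn'
    ((le_intDiv_iff c _ hD).mp hc) ((intDiv_le_iff d _ hD).mp hd)
  have h3 := List.all_eq_true.mp h2 _ hX
  have h4 := List.all_eq_true.mp h3 _ hY
  obtain ⟨e, he, hdec⟩ := List.any_eq_true.mp h4
  rw [decide_eq_true_eq] at hdec
  rw [List.mem_map] at he
  obtain ⟨q, hq, rfl⟩ := he
  have e1 : kacValue p p' r s n = q.1 := intDiv_eq_of_cross q.1 _ hD hdec.1
  have e2 : kacValue p p' r' s' n' = q.2 := intDiv_eq_of_cross q.2 _ hD hdec.2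
  rw [e1, e2]
  exact hq

/-- Empty exception list: no `KACJ` member lies in the box. -/
theorem not_mem_kacPairFamily_of_kacPairExcluded {N nmax : ℕ} {a b c d : ℚ}
    (h : kacPairExcluded N nmax a b c d [] = true) {v : ℚ × ℚ} (ha : a ≤ v.1) (hb : v.1 ≤ b)
    (hc : c ≤ v.2) (hd : v.2 ≤ d) : v ∉ kacPairFamily N nmax :=
  fun hv => by simpa using kacPairExcluded_sound h hv ha hb hc hd

/-- Real-number form of the `KACJ` sentence: a point of the real box `[a, b] × [c, d]` is no
unlisted same-model Kac pair. -/
theorem ne_kacPair_of_kacPairExcluded {N nmax : ℕ} {a b c d : ℚ} {ex : List (ℚ × ℚ)}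
    (h : kacPairExcluded N nmax a b c d ex = true) {x y : ℝ} (hx : (a : ℝ) ≤ x ∧ x ≤ b)
    (hy : (c : ℝ) ≤ y ∧ y ≤ d) (v : ℚ × ℚ) (hv : v ∈ kacPairFamily N nmax) (hvex : v ∉ ex) :
    (x, y) ≠ ((v.1 : ℝ), (v.2 : ℝ)) := by
  intro e
  have ex1 : x = (v.1 : ℝ) := congrArg Prod.fst e
  have ey1 : y = (v.2 : ℝ) := congrArg Prod.snd e
  rw [ex1] at hx
  rw [ey1] at hy
  exact hvex (kacPairExcluded_sound h hv (by exact_mod_cast hx.1) (by exact_mod_cast hx.2)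
    (by exact_mod_cast hy.1) (by exact_mod_cast hy.2))

/-! ### Bridge from the floor's statement -/

/-- **`KACJ` sentence (joint, kind `DeltaPair`).** If `IsingEnclosure W R`, the region `R` lies in
the rational box `[a, b] × [c, d]`, and `kacPairExcluded N nmax a b c d ex = true`, then no `σ–ε`
datum satisfying the bootstrap axioms with `(Δ_σ, Δ_ε) ∈ W` has `(Δ_σ, Δ_ε)` equal to a same-model
Virasoro pair of `KACJ(N, nmax)` outside `ex`.  (Sharper than the two projections
`sigma_not_kac_of_isingEnclosure` / `eps_not_kac_of_isingEnclosure` whenever both single-datum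
exception lists are non-empty.) -/
theorem pair_not_kacj_of_isingEnclosure {W R : Set (ℝ × ℝ)} (h : IsingEnclosure W R)
    {a b c d : ℚ}
    (hR : ∀ q ∈ R, ((a : ℝ) ≤ q.1 ∧ q.1 ≤ (b : ℝ)) ∧ ((c : ℝ) ≤ q.2 ∧ q.2 ≤ (d : ℝ)))
    {N nmax : ℕ} {ex : List (ℚ × ℚ)} (hx : kacPairExcluded N nmax a b c d ex = true)
    (D : SigmaEpsilonData) (hD : D.SatisfiesBootstrapAxioms) (hW : (D.Δσ, D.Δε) ∈ W)
    (v : ℚ × ℚ) (hv : v ∈ kacPairFamily N nmax) (hvex : v ∉ ex) :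
    (D.Δσ, D.Δε) ≠ ((v.1 : ℝ), (v.2 : ℝ)) :=
  ne_kacPair_of_kacPairExcluded hx (hR _ (h D hD hW)).1 (hR _ (h D hD hW)).2 v hv hvex

/-! ### 2D control and a synthetic validation box (`decide +kernel`; no 3D digit) -/

/-- **2D control, joint, COARSE width `10⁻³`.** In the box `[1/8 ± 10⁻³] × [1 ± 10⁻³]` the only
same-model Virasoro pair (`p′ ≤ 24`, levels `≤ 8`) is `(1/8, 1)` (attained by `M(3,4)` at levels
`(0,0)`, by `M(5,12)` at levels `(0,0)` and by `M(3,20)` at levels `(2,1)` — one VALUE pair).  Python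
twin: `tools/kacpair_exceptions.py --lo-s 0.124 --hi-s 0.126 --lo-e 0.999 --hi-e 1.001`. -/
theorem kacPairExcluded_control_pair3 :
    kacPairExcluded 24 8 (1 / 8 - 1 / 1000) (1 / 8 + 1 / 1000) (1 - 1 / 1000) (1 + 1 / 1000)
      [(1 / 8, 1)] = true := by
  decide +kernel

/-- Non-vacuity: with the empty list the same check fails (the pair `(1/8, 1)` is found). -/
theorem kacPairExcluded_control_pair3_minimal :
    kacPairExcluded 24 8 (1 / 8 - 1 / 1000) (1 / 8 + 1 / 1000) (1 - 1 / 1000) (1 + 1 / 1000)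
      [] = false := by
  decide +kernel

/-- **Printed shape of the joint 2D control.** A same-model Virasoro pair (`p′ ≤ 24`, levels `≤ 8`)
within `10⁻³` of `(1/8, 1)` in each coordinate IS `(1/8, 1)`. -/
theorem control_pair_kacj_unique {v : ℚ × ℚ} (hv : v ∈ kacPairFamily 24 8)
    (h1 : |v.1 - 1 / 8| ≤ 1 / 1000) (h2 : |v.2 - 1| ≤ 1 / 1000) : v = (1 / 8, 1) := by
  have ha := (abs_le.mp h1).1
  have hb := (abs_le.mp h1).2
  have hc := (abs_le.mp h2).1
  have hd := (abs_le.mp h2).2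
  have hmem := kacPairExcluded_sound kacPairExcluded_control_pair3 hv (by linarith) (by linarith)
    (by linarith) (by linarith)
  simpa using hmem

/-! ### Rule R3 for `KACJ`: a complete list settles every sub-box (no re-scan) -/

/-- **Refinement.** A complete `KACJ` list `ex` on the box `[a, b] × [c, d]` yields, for any sub-box
`[a', b'] × [c', d']`, the complete list `ex.filter (inside the sub-box)` — successive certified rungs
of one datum pair re-use the first rung's list (the `KACJ` analogue of `not_mem_linFamily_of_refine` /
`trgFull_listed_of_refine`; here membership is decidable rational arithmetic, so the refined list is
literally a `List.filter`). -/
theorem kacPair_listed_of_subbox {N nmax : ℕ} {a b c d : ℚ} {ex : List (ℚ × ℚ)}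
    (h : kacPairExcluded N nmax a b c d ex = true) {a' b' c' d' : ℚ} (ha : a ≤ a') (hb : b' ≤ b)
    (hc : c ≤ c') (hd : d' ≤ d) {v : ℚ × ℚ} (hv : v ∈ kacPairFamily N nmax) (h1 : a' ≤ v.1)
    (h2 : v.1 ≤ b') (h3 : c' ≤ v.2) (h4 : v.2 ≤ d') :
    v ∈ ex.filter fun e => decide (a' ≤ e.1 ∧ e.1 ≤ b' ∧ c' ≤ e.2 ∧ e.2 ≤ d') := by
  rw [List.mem_filter, decide_eq_true_eq]
  exact ⟨kacPairExcluded_sound h hv (le_trans ha h1) (le_trans h2 hb) (le_trans hc h3)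
    (le_trans h4 hd), h1, h2, h3, h4⟩

/-! ### A synthetic validation box (no 3D digit) -/

/-- Validation box `[0.613, 0.623] × [2.713, 2.723]` (synthetic centre: golden ratio `0.6180…` /
`e = 2.7182…`; width `10⁻²` per axis = a phase-1 width): the COMPLETE list of same-model Virasoro
pairs, four value pairs — `(187/304, 827/304)` from `M(8,19)`, `(8/13, 19/7)` from `M(13,14)`,
`(156/253, 688/253)` from `M(22,23)`, `(130/209, 569/209)` from `M(11,19)` (twin
`tools/kacpair_exceptions.py --lo-s 0.613 --hi-s 0.623 --lo-e 2.713 --hi-e 2.723 --xcheck`: the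
recogniser of record agrees; the single-datum projections meet `12` resp. `23` Kac values, i.e.
`276` candidate pairs, of which only these `4` are same-model). -/
def validationPairKacjEx : List (ℚ × ℚ) :=
  [(187 / 304, 827 / 304), (8 / 13, 19 / 7), (156 / 253, 688 / 253), (130 / 209, 569 / 209)]

/-- The validation sentence: the list is complete. -/
theorem kacPairExcluded_validation :
    kacPairExcluded 24 8 (613 / 1000) (623 / 1000) (2713 / 1000) (2723 / 1000)
      validationPairKacjEx = true := by
  decide +kernel

/-- Minimality of the validation list: dropping its last entry makes the check fail. -/
theorem kacPairExcluded_validation_minimal :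
    kacPairExcluded 24 8 (613 / 1000) (623 / 1000) (2713 / 1000) (2723 / 1000)
      (validationPairKacjEx.take 3) = false := by
  decide +kernel

/-- Refinement instance: the sub-box `[0.617, 0.619] × [2.717, 2.719]` (width `2·10⁻³`) contains NO
same-model pair — read off the validation list by `kacPair_listed_of_subbox`, no table re-scan. -/
theorem validation_subbox_not_kacj {v : ℚ × ℚ} (h1 : 617 / 1000 ≤ v.1) (h2 : v.1 ≤ 619 / 1000)
    (h3 : 2717 / 1000 ≤ v.2) (h4 : v.2 ≤ 2719 / 1000) : v ∉ kacPairFamily 24 8 := by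
  intro hv
  have hm := kacPair_listed_of_subbox kacPairExcluded_validation (by norm_num) (by norm_num)
    (by norm_num) (by norm_num) hv h1 h2 h3 h4
  have he : (validationPairKacjEx.filter fun e : ℚ × ℚ =>
      decide ((617 / 1000 : ℚ) ≤ e.1 ∧ e.1 ≤ 619 / 1000 ∧ (2717 / 1000 : ℚ) ≤ e.2 ∧
        e.2 ≤ 2719 / 1000)) = [] := by
    decide +kernel
  rw [he] at hm
  simp at hm

end Summit.CriticalPhenomena.Ising3D
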